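import Mathlib
import HarnessLib
import Summits.Ventures.LatticeQCDFlow.Exactness.NCMCGeneralSpaceGammaMethodWindow

/-!
# Plug-in robustness of scorer A's Γ-method statistic: two `δ`-close bounded series have `8Cδ`-close `Γ̂(t)` and `(2W+1)·8Cδ`-close `Γ̂(0)·2τ̂_W`

HONEST FRAMING: exact (Metropolis-corrected) sampling algorithms for lattice gauge theory;
figures of merit are autocorrelation/cost numbers at stated couplings and volumes; no
continuum-physics claim.

Venture `LatticeQCDFlow` (cell pub-lqcd), topic `Exactness`; FANOUT row 13 (`eng-snf`, GEN-22).
NEW WORK of the cell (finite-sample algebra and two elementary facts about convergence in measure),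
not a published result; no definition is introduced; nothing is cited as a fact.  PURPOSE: the
Γ-method error bars of the root-type lanes (BAR, any monotone estimating equation) are computed on a
PLUG-IN series `ψ(d̂_n, X_i)` — the summand evaluated at the reported root `d̂_n`, not at the unknown
`d⋆`.  GEN-20's consistency of `Γ̂_N(0) · 2 τ̂_{N,W_N}` is for a FIXED bounded observable; this file
supplies the deterministic comparison that transfers it to the plug-in series: if `|x_i − y_i| ≤ δ`
and `|x_i|, |y_i| ≤ C` for `i < N`, then `|Γ̂_x(t) − Γ̂_y(t)| ≤ 8Cδ` for every lag and
`|Γ̂_x(0)·2τ̂_{x,W} − Γ̂_y(0)·2τ̂_{y,W}| ≤ (2W+1)·8Cδ`; so a `d ↦ ψ(d, ·)` that is `L`-Lipschitz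
uniformly in the sample gives a plug-in error `≤ (2W_N+1)·8C·L·|d̂_N − d⋆|`, which vanishes in
probability as soon as `W_N (d̂_N − d⋆) → 0` in probability (`√N`-consistency and `W_N²/N → 0`).

## Content

* §1 `abs_sampleMean_le_of_forall_lt`, `abs_sampleMean_sub_le_of_close`, `abs_dev_le_of_forall_lt`, `abs_dev_sub_le_of_close`,
  **`abs_acovSum_sub_le_of_close`** (`|S_x(t) − S_y(t)| ≤ (N − t)·8Cδ`),
  **`abs_gammaHat_sub_le_of_close`** (`|Γ̂_x(t) − Γ̂_y(t)| ≤ 8Cδ`),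
  **`abs_gammaWindow_sub_le_of_close`** (`|Γ̂_x(0)·2τ̂_{x,W} − Γ̂_y(0)·2τ̂_{y,W}| ≤ (2W+1)·8Cδ`).
* §2 measurability of the statistics of an `ω`-DEPENDENT series (`x_i(ω)` measurable for each `i`):
  `measurable_sampleMean_of`, `measurable_gammaHat_of`, `measurable_gammaWindow_of`.
* §3 two facts on convergence in measure to constants used by the plug-in step:
  `tendstoInMeasure_zero_of_abs_le_mul` (domination `|D_n| ≤ K|T_n|`, `T_n →ᴾ 0`),
  `tendstoInMeasure_of_sub_tendstoInMeasure_zero` (`B_n →ᴾ b`, `A_n − B_n →ᴾ 0` ⇒ `A_n →ᴾ b`).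

NOT CLAIMED: anything about a particular lane (see `NCMCGeneralSpaceBarRestartChainsGammaCoverage`);
random (data-driven) windows; anything numerical.
-/

namespace Summit.Ventures.LatticeQCDFlow.Exactness.GeneralNCMC

open MeasureTheory Filter Finset
open scoped Topology

/-! ## §1 Deterministic comparison of the Γ-method statistics of two close bounded series -/

section Algebra

variable {x y : ℕ → ℝ} {N : ℕ} {δ C : ℝ}

/-- `|x̄_N| ≤ C` when `|x_i| ≤ C` for `i < N` (`C ≥ 0`). -/
theorem abs_sampleMean_le_of_forall_lt (hC : 0 ≤ C) (hx : ∀ i < N, |x i| ≤ C) :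
    |Scoring.sampleMean x N| ≤ C := by
  unfold Scoring.sampleMean
  rcases Nat.eq_zero_or_pos N with hN | hN
  · subst hN; simpa using hC
  have hNr : (0 : ℝ) < N := by exact_mod_cast hN
  rw [abs_div, abs_of_pos hNr, div_le_iff₀ hNr]
  calc |∑ i ∈ range N, x i| ≤ ∑ i ∈ range N, |x i| := abs_sum_le_sum_abs _ _
    _ ≤ ∑ _i ∈ range N, C := sum_le_sum fun i hi => hx i (mem_range.1 hi)
    _ = C * N := by rw [sum_const, card_range, nsmul_eq_mul, mul_comm]

/-- Sample means of two `δ`-close series are `δ`-close. -/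
theorem abs_sampleMean_sub_le_of_close (hδ : 0 ≤ δ) (hxy : ∀ i < N, |x i - y i| ≤ δ) :
    |Scoring.sampleMean x N - Scoring.sampleMean y N| ≤ δ := by
  unfold Scoring.sampleMean
  rcases Nat.eq_zero_or_pos N with hN | hN
  · subst hN; simpa using hδ
  have hNr : (0 : ℝ) < N := by exact_mod_cast hN
  rw [← sub_div, ← sum_sub_distrib, abs_div, abs_of_pos hNr, div_le_iff₀ hNr]
  calc |∑ i ∈ range N, (x i - y i)| ≤ ∑ i ∈ range N, |x i - y i| := abs_sum_le_sum_abs _ _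
    _ ≤ ∑ _i ∈ range N, δ := sum_le_sum fun i hi => hxy i (mem_range.1 hi)
    _ = δ * N := by rw [sum_const, card_range, nsmul_eq_mul, mul_comm]

/-- Deviations from the sample mean are bounded by `2C`. -/
theorem abs_dev_le_of_forall_lt (hC : 0 ≤ C) (hx : ∀ i < N, |x i| ≤ C) {i : ℕ} (hi : i < N) :
    |Scoring.dev x N i| ≤ 2 * C := by
  unfold Scoring.dev
  calc |x i - Scoring.sampleMean x N| ≤ |x i| + |Scoring.sampleMean x N| := abs_sub _ _
    _ ≤ C + C := add_le_add (hx i hi) (abs_sampleMean_le_of_forall_lt hC hx)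
    _ = 2 * C := by ring

/-- Deviations of two `δ`-close series are `2δ`-close. -/
theorem abs_dev_sub_le_of_close (hδ : 0 ≤ δ) (hxy : ∀ i < N, |x i - y i| ≤ δ) {i : ℕ} (hi : i < N) :
    |Scoring.dev x N i - Scoring.dev y N i| ≤ 2 * δ := by
  unfold Scoring.dev
  calc |x i - Scoring.sampleMean x N - (y i - Scoring.sampleMean y N)|
      = |(x i - y i) - (Scoring.sampleMean x N - Scoring.sampleMean y N)| := by ring_nf
    _ ≤ |x i - y i| + |Scoring.sampleMean x N - Scoring.sampleMean y N| := abs_sub _ _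
    _ ≤ δ + δ := add_le_add (hxy i hi) (abs_sampleMean_sub_le_of_close hδ hxy)
    _ = 2 * δ := by ring

/-- **Lag sums**: `|S_x(t) − S_y(t)| ≤ (N − t) · 8Cδ`. -/
theorem abs_acovSum_sub_le_of_close (hδ : 0 ≤ δ) (hC : 0 ≤ C) (hx : ∀ i < N, |x i| ≤ C)
    (hy : ∀ i < N, |y i| ≤ C) (hxy : ∀ i < N, |x i - y i| ≤ δ) (t : ℕ) :
    |Scoring.acovSum x N t - Scoring.acovSum y N t| ≤ ((N - t : ℕ) : ℝ) * (8 * C * δ) := by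
  unfold Scoring.acovSum Scoring.lagSum
  rw [← sum_sub_distrib]
  calc |∑ i ∈ range (N - t), (Scoring.dev x N i * Scoring.dev x N (i + t)
          - Scoring.dev y N i * Scoring.dev y N (i + t))|
      ≤ ∑ i ∈ range (N - t), |Scoring.dev x N i * Scoring.dev x N (i + t)
          - Scoring.dev y N i * Scoring.dev y N (i + t)| := abs_sum_le_sum_abs _ _
    _ ≤ ∑ _i ∈ range (N - t), 8 * C * δ := sum_le_sum fun i hi => ?_
    _ = ((N - t : ℕ) : ℝ) * (8 * C * δ) := by rw [sum_const, card_range, nsmul_eq_mul]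
  have hi : i < N - t := mem_range.1 hi
  have hiN : i < N := by omega
  have hitN : i + t < N := by omega
  have hsplit : Scoring.dev x N i * Scoring.dev x N (i + t) - Scoring.dev y N i * Scoring.dev y N (i + t)
      = Scoring.dev x N i * (Scoring.dev x N (i + t) - Scoring.dev y N (i + t))
        + (Scoring.dev x N i - Scoring.dev y N i) * Scoring.dev y N (i + t) := by ring
  rw [hsplit]
  calc |Scoring.dev x N i * (Scoring.dev x N (i + t) - Scoring.dev y N (i + t))
          + (Scoring.dev x N i - Scoring.dev y N i) * Scoring.dev y N (i + t)|
      ≤ |Scoring.dev x N i * (Scoring.dev x N (i + t) - Scoring.dev y N (i + t))|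
          + |(Scoring.dev x N i - Scoring.dev y N i) * Scoring.dev y N (i + t)| := abs_add_le _ _
    _ = |Scoring.dev x N i| * |Scoring.dev x N (i + t) - Scoring.dev y N (i + t)|
          + |Scoring.dev x N i - Scoring.dev y N i| * |Scoring.dev y N (i + t)| := by
        rw [abs_mul, abs_mul]
    _ ≤ 2 * C * (2 * δ) + 2 * δ * (2 * C) :=
        add_le_add
          (mul_le_mul (abs_dev_le_of_forall_lt hC hx hiN) (abs_dev_sub_le_of_close hδ hxy hitN) (abs_nonneg _)
            (by positivity))
          (mul_le_mul (abs_dev_sub_le_of_close hδ hxy hiN) (abs_dev_le_of_forall_lt hC hy hitN) (abs_nonneg _)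
            (by positivity))
    _ = 8 * C * δ := by ring

/-- **Autocovariance estimates**: `|Γ̂_x(t) − Γ̂_y(t)| ≤ 8Cδ` at every lag. -/
theorem abs_gammaHat_sub_le_of_close (hδ : 0 ≤ δ) (hC : 0 ≤ C) (hx : ∀ i < N, |x i| ≤ C)
    (hy : ∀ i < N, |y i| ≤ C) (hxy : ∀ i < N, |x i - y i| ≤ δ) (t : ℕ) :
    |Scoring.gammaHat x N t - Scoring.gammaHat y N t| ≤ 8 * C * δ := by
  unfold Scoring.gammaHat
  rw [← sub_div]
  rcases Nat.eq_zero_or_pos (N - t) with h0 | hpos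
  · rw [h0, Nat.cast_zero, div_zero, abs_zero]; positivity
  have hr : (0 : ℝ) < ((N - t : ℕ) : ℝ) := by exact_mod_cast hpos
  rw [abs_div, abs_of_pos hr, div_le_iff₀ hr, mul_comm]
  exact abs_acovSum_sub_le_of_close hδ hC hx hy hxy t

/-- **The windowed statistic**: `|Γ̂_x(0)·2τ̂_{x,W} − Γ̂_y(0)·2τ̂_{y,W}| ≤ (2W + 1)·8Cδ`. -/
theorem abs_gammaWindow_sub_le_of_close (hδ : 0 ≤ δ) (hC : 0 ≤ C) (hx : ∀ i < N, |x i| ≤ C)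
    (hy : ∀ i < N, |y i| ≤ C) (hxy : ∀ i < N, |x i - y i| ≤ δ) (W : ℕ) :
    |Scoring.gammaHat x N 0 * (2 * Scoring.tauIntWindow (Scoring.rhoHat x N) W)
      - Scoring.gammaHat y N 0 * (2 * Scoring.tauIntWindow (Scoring.rhoHat y N) W)|
      ≤ (2 * W + 1) * (8 * C * δ) := by
  rw [← gammaWindow_eq_gammaHat_mul_tauIntWindow x N W, ← gammaWindow_eq_gammaHat_mul_tauIntWindow y N W]
  have hsplit : Scoring.gammaHat x N 0 + 2 * ∑ t ∈ range W, Scoring.gammaHat x N (t + 1)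
        - (Scoring.gammaHat y N 0 + 2 * ∑ t ∈ range W, Scoring.gammaHat y N (t + 1))
      = (Scoring.gammaHat x N 0 - Scoring.gammaHat y N 0)
        + 2 * ∑ t ∈ range W, (Scoring.gammaHat x N (t + 1) - Scoring.gammaHat y N (t + 1)) := by
    rw [sum_sub_distrib]; ring
  rw [hsplit]
  calc |Scoring.gammaHat x N 0 - Scoring.gammaHat y N 0
          + 2 * ∑ t ∈ range W, (Scoring.gammaHat x N (t + 1) - Scoring.gammaHat y N (t + 1))|
      ≤ |Scoring.gammaHat x N 0 - Scoring.gammaHat y N 0|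
          + |2 * ∑ t ∈ range W, (Scoring.gammaHat x N (t + 1) - Scoring.gammaHat y N (t + 1))| :=
        abs_add_le _ _
    _ ≤ 8 * C * δ + 2 * ∑ _t ∈ range W, 8 * C * δ := by
        refine add_le_add (abs_gammaHat_sub_le_of_close hδ hC hx hy hxy 0) ?_
        rw [abs_mul, abs_of_pos (by norm_num : (0 : ℝ) < 2)]
        exact mul_le_mul_of_nonneg_left ((abs_sum_le_sum_abs _ _).trans
          (sum_le_sum fun t _ => abs_gammaHat_sub_le_of_close hδ hC hx hy hxy (t + 1))) zero_le_two
    _ = (2 * W + 1) * (8 * C * δ) := by rw [sum_const, card_range, nsmul_eq_mul]; ring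

end Algebra

/-! ## §2 Measurability of the statistics of an `ω`-dependent series -/

section Measurability

variable {Ω₀ : Type*} [MeasurableSpace Ω₀] {x : ℕ → Ω₀ → ℝ}

/-- The sample mean of a series of measurable functions is measurable. -/
theorem measurable_sampleMean_of (hx : ∀ i, Measurable (x i)) (N : ℕ) :
    Measurable fun ω => Scoring.sampleMean (fun i => x i ω) N := by
  unfold Scoring.sampleMean
  exact (Finset.measurable_sum _ fun i _ => hx i).div_const _

/-- `Γ̂_N(t)` of a series of measurable functions is measurable. -/
theorem measurable_gammaHat_of (hx : ∀ i, Measurable (x i)) (N t : ℕ) :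
    Measurable fun ω => Scoring.gammaHat (fun i => x i ω) N t := by
  unfold Scoring.gammaHat Scoring.acovSum Scoring.lagSum Scoring.dev
  refine (Finset.measurable_sum _ fun i _ => ?_).div_const _
  exact ((hx i).sub (measurable_sampleMean_of hx N)).mul
    ((hx (i + t)).sub (measurable_sampleMean_of hx N))

/-- `Γ̂_N(0) · 2 τ̂_{N,W}` of a series of measurable functions is measurable. -/
theorem measurable_gammaWindow_of (hx : ∀ i, Measurable (x i)) (N W : ℕ) :
    Measurable fun ω => Scoring.gammaHat (fun i => x i ω) N 0
      * (2 * Scoring.tauIntWindow (Scoring.rhoHat (fun i => x i ω) N) W) := by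
  have h : (fun ω => Scoring.gammaHat (fun i => x i ω) N 0
      * (2 * Scoring.tauIntWindow (Scoring.rhoHat (fun i => x i ω) N) W))
      = fun ω => Scoring.gammaHat (fun i => x i ω) N 0
        + 2 * ∑ t ∈ range W, Scoring.gammaHat (fun i => x i ω) N (t + 1) := by
    funext ω
    exact (gammaWindow_eq_gammaHat_mul_tauIntWindow (fun i => x i ω) N W).symm
  rw [h]
  exact (measurable_gammaHat_of hx N 0).add
    ((Finset.measurable_sum _ fun t _ => measurable_gammaHat_of hx N (t + 1)).const_mul 2)

end Measurability

/-! ## §3 Two facts on convergence in measure to constants -/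

section InMeasure

variable {Ω₀ : Type*} [MeasurableSpace Ω₀] {P : Measure Ω₀}

/-- **Domination**: if `|D_n| ≤ K |T_n|` pointwise and `T_n → 0` in measure, then `D_n → 0` in
measure. -/
theorem tendstoInMeasure_zero_of_abs_le_mul {D T : ℕ → Ω₀ → ℝ} {K : ℝ}
    (hT : TendstoInMeasure P T atTop (fun _ => (0 : ℝ))) (hK : 0 < K)
    (hle : ∀ n ω, |D n ω| ≤ K * |T n ω|) :
    TendstoInMeasure P D atTop (fun _ => (0 : ℝ)) := by
  rw [tendstoInMeasure_iff_norm] at hT ⊢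
  intro ε hε
  have hT' := hT (ε / K) (div_pos hε hK)
  refine tendsto_of_tendsto_of_tendsto_of_le_of_le tendsto_const_nhds hT' (fun n => bot_le)
    fun n => measure_mono fun ω hω => ?_
  simp only [Set.mem_setOf_eq, sub_zero, Real.norm_eq_abs] at hω ⊢
  rw [div_le_iff₀ hK]
  calc ε ≤ |D n ω| := hω
    _ ≤ K * |T n ω| := hle n ω
    _ = |T n ω| * K := mul_comm _ _

/-- **Perturbation**: if `B_n → b` in measure and `A_n − B_n → 0` in measure, then `A_n → b` in
measure. -/
theorem tendstoInMeasure_of_sub_tendstoInMeasure_zero {A B : ℕ → Ω₀ → ℝ} {b : ℝ}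
    (hB : TendstoInMeasure P B atTop (fun _ => b))
    (hD : TendstoInMeasure P (fun n ω => A n ω - B n ω) atTop (fun _ => (0 : ℝ))) :
    TendstoInMeasure P A atTop (fun _ => b) := by
  rw [tendstoInMeasure_iff_norm] at hB hD ⊢
  intro ε hε
  have h2 : (0 : ℝ) < ε / 2 := by linarith
  have hsum := (hB (ε / 2) h2).add (hD (ε / 2) h2)
  rw [add_zero] at hsum
  refine tendsto_of_tendsto_of_tendsto_of_le_of_le tendsto_const_nhds hsum (fun n => bot_le)
    fun n => (measure_mono fun ω hω => ?_).trans (measure_union_le _ _)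
  simp only [Set.mem_setOf_eq, Set.mem_union, sub_zero, Real.norm_eq_abs] at hω ⊢
  by_contra hcon
  rw [not_or, not_le, not_le] at hcon
  linarith [hcon.1, hcon.2, abs_sub_le (A n ω) (B n ω) b]

end InMeasure

end Summit.Ventures.LatticeQCDFlow.Exactness.GeneralNCMC
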